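import Literature.NumberTheory.EllipticCurves.Greenberg1999.ControlLocalKernelsLayerGoodInputsProofs
import Literature.NumberTheory.EllipticCurves.IwasawaSelmerControlKernelCardProofs
import HarnessLib

/-!
# Greenberg's Lemma 3.3 at EVERY layer and EVERY `v ∤ p` (any reduction type), counted on the
# `p`-torsion: `#𝒦_{v,n}[p] ≤ p²` — the universal local constant of the TOWER gap certificate

`Proofs` file (theorems only: **no definition, no named fact, nothing asserted**), sibling of
`ControlLocalKernelsLayerGoodProofs` (which discharged Lemma 3.3 at GOOD `v ∤ p`). Source: R. Greenberg,
*Iwasawa theory for elliptic curves*, LNM 1716 (1999), §3, proof of Lemma 3.3 (held copy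
`book:coatesnd-arithmetic-theory-elliptic-curves`, PDF p. 87): "`ker(r_{v_n}) ≅ H¹(Γ_{v_n}, B_v) ≅
B_v/(γ_{v_n} − 1)B_v`" with "The group `B_v` is isomorphic to `(ℚ_p/ℤ_p)^e ×` (a finite group), where
`0 ≤ e ≤ 2`" — whence every subquotient of `B_v ⊆ E[p^∞]` has `p`-rank `≤ 2`. The tree's named facts
for the BAD places `v ∤ p` (`lemma33_natCard_localTowerKerPrimary_le`, eq. (4);
`lemma33_localTowerKerPrimary_cyclic_of_multiplicative` / `…_le_four_of_additive`, the p. 88 readings) are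
consumed by the TOWER doors of route ByReductionTypeAtTwo (item stmt-BirchSwinnertonDyer-19271) only
through their projection to the `p`-TORSION `#𝒦_{v,n}[p] ≤ C_v` (`Greenberg1999.pTorsion_le_of_lemma33_*`,
`Theorems/ByReductionTypeAtTwoTowerLayerNumeric.pTorsion_localTowerKer_le_of_numeric`: `C_v = 4` needs
"nothing" but was read from the additive fact `hA`). **This file proves the `p`-torsion bound
unconditionally, for every reduction type:**

* `finite_and_natCard_pTorsion_localTowerKerPrimary_le_sq`: for an elliptic curve `E` over a number
  field `K`, a prime `p`, ANY `ℤ_p`-extension `κ`, ANY finite place `v ∤ p` and every `n`, the classes of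
  `𝒦_{v,n}[p^∞]` killed by `p` are finitely many and `#𝒦_{v,n}[p] ≤ p²` — in the exact shape of the
  hypothesis (hC) of `towerGapAtTwo_of_localKernelBounds` (at `p = 2`: `C_v = 4` at every odd place,
  PRINT-free; the binder `hA` of the doors becomes unnecessary).

Ingredients (all in the tree or elementary):
* §0 `finite_and_natCard_pTorsion_quotient_le` (pure algebra): for a `p`-primary abelian group `B`
  with every `B[p^k]` finite and any subgroup `C`, `#(B/C)[p] ≤ #B[p]` (finite-level counting:
  `#X[p] = #(X/pX)` for finite `X`, `ResKernel.natCard_quotient_range_eq_natCard_ker`).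
* §1 `exists_addMonoidHom_localTowerKer_injective`: the tree's local inflation–restriction
  (`finite_localTowerKerPrimary_and_card_le`, `IwasawaSelmerControlLocalInputsProofs`) in HOMOMORPHISM
  form `𝒦_{v,n} ↪ M_∞/(g − 1)M_∞`, `M_∞ = E(K̄_v)^{H_{v,∞}}` — no finiteness of the target needed
  (`ResKernel.exists_addMonoidHom_subgroupResKer_injective`).
* §2 the `p`-power torsion of `M_∞/(g − 1)M_∞` is represented by `B = M_∞[p^∞]` as soon as `M_∞/B` is
  `p`-divisible (the representative step of `PrimaryCoinvariants.finite_primaryComponent_quotient`).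
* §3 at `v ∤ p`: `M_∞/B` IS `p`-divisible (Kodaira–Néron over `K_v^nr` and division in `E₁` —
  `exists_nsmul_mem_kernel_of_forall_inertia`, `exists_pow_nsmul_eq_of_mem_kernel` of
  `IwasawaSelmerControlAwayFromPProofs`, step (a) of the tree's layer-`0` Lemma 3.3 verbatim), so
  `𝒦_{v,n}[p] ↪ (B/C)[p]` for `C = ker(B → M_∞/(g−1)M_∞)`, and `#B[p] ≤ #E(K̄_v)[p] = p²`
  (`card_torsionPoints_eq_sq_holds`, Silverman III.6.4).

What is NOT proved: the sharper p. 88 readings (`hM`: cyclic at multiplicative `v`, order `c_v^{(p)}`;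
these need the Tate parametrisation up the unramified tower) and anything at `v ∣ p` (Lemma 3.4: there
`M_∞/B` is not `p`-divisible). HONEST FRAMING (cell `bsd-2adic`, seat `bsd-2adic-tower-1` GEN 3, HUMAN
RULING D-0074 (T1)): tool theorem; closes no item by itself.

## References

* [GreenbergLNM1716] R. Greenberg, LNM 1716 (1999), §3 Lemma 3.3 (PDF pp. 86–88), §2 Prop. 2.1.
* [SilvermanAEC2009] J. H. Silverman, *AEC*, 2nd ed. (2009), Cor. III.6.4, Prop. VII.3.1, Cor. VII.6.2.

## Design

No definitions, no named facts; `noncomputable section`, `open scoped Classical NNReal`, one universe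
`u`; root namespaces opened as `_root_.…` inside `namespace Literature.…` (lean/CONVENTIONS.md §2);
`set_option maxHeartbeats 1600000 in` on the two transport-heavy declarations (as in the tree's layer-`0`
file). Axioms: `propext`, `Classical.choice`, `Quot.sound`.
-/

noncomputable section

open scoped Classical NNReal

open NumberField IsDedekindDomain Field

universe u

namespace Literature.NumberTheory.EllipticCurves.Greenberg1999

open Literature.NumberTheory.EllipticCurves Literature.NumberTheory.GaloisRepresentations
  Literature.NumberTheory.EllipticCurves.FormalGroupChart Literature.NumberTheory.EllipticCurves.ResKernel
  _root_.Field _root_.IsDedekindDomain.HeightOneSpectrum _root_.WeierstrassCurve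

/-! ## §0 Pure algebra: the `p`-rank of a quotient of a `p`-primary group with finite `p^k`-torsion -/

/-- **The `p`-torsion of a quotient is at most the `p`-torsion** (in number): for an abelian group
`B` in which every element is killed by a power of `p` and every `B[p^k]` is finite, and any subgroup
`C`, the classes of `B/C` killed by `p` are finitely many, at most `#B[p]`. Proof: finitely many such
classes lift into some finite `A = B[p^N]`, where they embed into `(A/(C ∩ A))[p]`, and for the finite
group `A' = A/(C ∩ A)`: `#A'[p] = #A'/pA' ≤ #A/pA = #A[p] ≤ #B[p]` (`#X[p] = #X/pX` for finite `X`,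
`ResKernel.natCard_quotient_range_eq_natCard_ker`). (For `B ≤ (ℚ_p/ℤ_p)²`: every subquotient has
`p`-rank `≤ 2`; Greenberg, LNM 1716, proof of Lemma 3.3, p. 87: "`B_v ≅ (ℚ_p/ℤ_p)^e ×` (a finite
group), where `0 ≤ e ≤ 2`".) [cite: GreenbergLNM1716, §3 Lemma 3.3 (proof, p. 87)] -/
theorem finite_and_natCard_pTorsion_quotient_le {B : Type*} [AddCommGroup B] {p : ℕ}
    (hprim : ∀ b : B, ∃ n : ℕ, p ^ n • b = 0)
    (hfin : ∀ n : ℕ, Finite (nsmulAddMonoidHom (p ^ n) : B →+ B).ker) (C : AddSubgroup B) :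
    Finite {x : B ⧸ C // p • x = 0} ∧
      Nat.card {x : B ⧸ C // p • x = 0} ≤ Nat.card (nsmulAddMonoidHom p : B →+ B).ker := by
  classical
  set R : ℕ := Nat.card (nsmulAddMonoidHom p : B →+ B).ker with hR
  haveI hfin1 : Finite (nsmulAddMonoidHom p : B →+ B).ker := by
    have := hfin 1; rwa [pow_one] at this
  -- every finset of `p`-torsion classes has at most `R` elements
  have key : ∀ F : Finset {x : B ⧸ C // p • x = 0}, F.card ≤ R := by
    intro F
    choose lift hlift using (QuotientAddGroup.mk_surjective (s := C))
    choose n hn using hprim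
    let N : ℕ := F.sum fun q ↦ n (lift q.1)
    let A : AddSubgroup B := (nsmulAddMonoidHom (p ^ N) : B →+ B).ker
    haveI : Finite A := hfin N
    have hmemN : ∀ q ∈ F, lift q.1 ∈ A := by
      intro q hq
      have hle : n (lift q.1) ≤ N := Finset.single_le_sum (f := fun q ↦ n (lift q.1))
        (fun _ _ ↦ Nat.zero_le _) hq
      change (nsmulAddMonoidHom (p ^ N) : B →+ B) (lift q.1) = 0
      rw [nsmulAddMonoidHom_apply, ← pow_mul_pow_sub p hle, mul_comm, mul_smul, hn (lift q.1),
        smul_zero]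
    -- `A' = A / (C ∩ A)`
    let CA : AddSubgroup A := C.comap A.subtype
    let A' := A ⧸ CA
    haveI : Finite A' := inferInstance
    -- the injection `F ↪ A'[p]`
    let ι : {q // q ∈ F} → (nsmulAddMonoidHom p : A' →+ A').ker := fun q ↦
      ⟨QuotientAddGroup.mk (⟨lift q.1.1, hmemN q.1 q.2⟩ : A), by
        rw [AddMonoidHom.mem_ker, nsmulAddMonoidHom_apply, ← QuotientAddGroup.mk_nsmul,
          QuotientAddGroup.eq_zero_iff]
        change ((p • (⟨lift q.1.1, hmemN q.1 q.2⟩ : A) : A) : B) ∈ C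
        rw [AddSubgroupClass.coe_nsmul]
        have h := q.1.2
        rw [← hlift q.1.1, ← QuotientAddGroup.mk_nsmul, QuotientAddGroup.eq_zero_iff] at h
        exact h⟩
    have hι : Function.Injective ι := by
      intro a b hab
      have h1 := congrArg (fun z : (nsmulAddMonoidHom p : A' →+ A').ker ↦ (z : A')) hab
      simp only [ι] at h1
      rw [QuotientAddGroup.eq_iff_sub_mem] at h1
      change (((⟨lift a.1.1, _⟩ : A) - ⟨lift b.1.1, _⟩ : A) : B) ∈ C at h1
      rw [AddSubgroupClass.coe_sub] at h1
      change lift a.1.1 - lift b.1.1 ∈ C at h1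
      have h2 : (a.1.1 : B ⧸ C) = b.1.1 := by
        rw [← hlift a.1.1, ← hlift b.1.1, QuotientAddGroup.eq_iff_sub_mem]
        exact h1
      exact Subtype.ext (Subtype.ext h2)
    -- `#A'[p] = #A'/pA' ≤ #A/pA = #A[p] ≤ R`
    have hA'p : Nat.card (nsmulAddMonoidHom p : A' →+ A').ker =
        Nat.card (A' ⧸ (nsmulAddMonoidHom p : A' →+ A').range) :=
      (ResKernel.natCard_quotient_range_eq_natCard_ker _).symm
    have hAp : Nat.card (nsmulAddMonoidHom p : A →+ A).ker =
        Nat.card (A ⧸ (nsmulAddMonoidHom p : A →+ A).range) :=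
      (ResKernel.natCard_quotient_range_eq_natCard_ker _).symm
    -- the surjection `A/pA → A'/pA'`
    have hsurj : Nat.card (A' ⧸ (nsmulAddMonoidHom p : A' →+ A').range) ≤
        Nat.card (A ⧸ (nsmulAddMonoidHom p : A →+ A).range) := by
      let σ : A ⧸ (nsmulAddMonoidHom p : A →+ A).range →+
          A' ⧸ (nsmulAddMonoidHom p : A' →+ A').range :=
        QuotientAddGroup.map _ _ (QuotientAddGroup.mk' CA) (by
          rintro _ ⟨a, rfl⟩
          exact ⟨QuotientAddGroup.mk a, by
            rw [nsmulAddMonoidHom_apply, nsmulAddMonoidHom_apply, QuotientAddGroup.mk'_apply,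
              QuotientAddGroup.mk_nsmul]⟩)
      have hσ : Function.Surjective σ := by
        intro y
        induction y using QuotientAddGroup.induction_on with
        | H x =>
          induction x using QuotientAddGroup.induction_on with
          | H a => exact ⟨QuotientAddGroup.mk a, rfl⟩
      exact Nat.card_le_card_of_surjective σ hσ
    -- `A[p] ↪ B[p]`
    have hAB : Nat.card (nsmulAddMonoidHom p : A →+ A).ker ≤ R := by
      refine Nat.card_le_card_of_injective (fun x ↦ (⟨((x : A) : B), ?_⟩ :
        (nsmulAddMonoidHom p : B →+ B).ker)) ?_
      · have hx : p • (x : A) = 0 := (AddMonoidHom.mem_ker).mp x.2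
        rw [AddMonoidHom.mem_ker, nsmulAddMonoidHom_apply, ← AddSubgroupClass.coe_nsmul, hx,
          ZeroMemClass.coe_zero]
      · intro a b hab
        apply Subtype.ext; apply Subtype.ext
        exact congrArg (fun z : (nsmulAddMonoidHom p : B →+ B).ker ↦ (z : B)) hab
    have hF : F.card = Nat.card {q // q ∈ F} := by
      rw [Nat.card_eq_fintype_card, Fintype.card_coe]
    rw [hF]
    calc Nat.card {q // q ∈ F} ≤ Nat.card (nsmulAddMonoidHom p : A' →+ A').ker :=
          Nat.card_le_card_of_injective ι hι
      _ ≤ Nat.card (nsmulAddMonoidHom p : A →+ A).ker := by rw [hA'p, hAp]; exact hsurj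
      _ ≤ R := hAB
  have hfinite : Finite {x : B ⧸ C // p • x = 0} := by
    by_contra hinf
    rw [not_finite_iff_infinite] at hinf
    obtain ⟨F, hF⟩ := Infinite.exists_subset_card_eq {x : B ⧸ C // p • x = 0} (R + 1)
    have := key F
    omega
  refine ⟨hfinite, ?_⟩
  haveI := Fintype.ofFinite {x : B ⧸ C // p • x = 0}
  rw [Nat.card_eq_fintype_card, ← Finset.card_univ]
  exact key _


/-! ## §1 The local tower kernel embeds into the coinvariants (as a homomorphism, any place `E`) -/

section Embedding

variable {K : Type u} [Field K] (W : WeierstrassCurve K) {p : ℕ} [Fact p.Prime]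
  (κ : ZpExtension K p) (E : Type u) [Field E] [Algebra K E]

set_option maxHeartbeats 1600000 in
/-- **Local inflation–restriction as an injective homomorphism
`𝒦_{E,n} ↪ M_∞/(g − 1)M_∞`**, `M_∞ = E(K̄_E)^{H_{E,∞}}`, `g ∈ H_{E,n}` generating `H_{E,n}`
topologically together with `H_{E,∞}` (such `g` exist: `exists_mem_localSubgroup_generate`). The
homomorphism form of the tree's `finite_localTowerKerPrimary_and_card_le` (which records only the
induced inequality of cardinalities, hence needs the target to be finite): the generic embedding
`ResKernel.exists_addMonoidHom_subgroupResKer_injective` on the topological group `H_{E,n}` with its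
normal subgroup `H_{E,∞}`, transported along `H_{E,∞}.subgroupOf H_{E,n} ≃ H_{E,∞}`. Greenberg, LNM
1716, proof of Lemma 3.3, p. 87: "`ker(r_{v_n}) ≅ H¹(Γ_{v_n}, B_v) ≅ B_v/(γ_{v_n} − 1)B_v`".
[cite: GreenbergLNM1716, §3 Lemma 3.3 (proof, p. 87)] -/
theorem exists_addMonoidHom_localTowerKer_injective (n : ℕ) {g : Field.absoluteGaloisGroup E}
    (hg : g ∈ localSubgroup (κ.layerSubgroup n) E)
    (hgen : ∀ U : Subgroup (Field.absoluteGaloisGroup E),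
      IsOpen (U : Set (Field.absoluteGaloisGroup E)) → localSubgroup κ.kerSubgroup E ≤ U →
        g ∈ U → localSubgroup (κ.layerSubgroup n) E ≤ U) :
    ∃ ψ : W.localTowerKer κ E n →+
        FixedPoints.addSubgroup (localSubgroup κ.kerSubgroup E) (localPoints W E) ⧸
          (subOne (localSubgroup κ.kerSubgroup E) (localPoints W E) g).range,
      Function.Injective ψ := by
  -- notation
  let P : Type u := localPoints W E
  let Hn : Subgroup (Field.absoluteGaloisGroup E) := localSubgroup (κ.layerSubgroup n) E
  let Hi : Subgroup (Field.absoluteGaloisGroup E) := localSubgroup κ.kerSubgroup E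
  let N : Subgroup Hn := Hi.subgroupOf Hn
  let γ : Hn := ⟨g, hg⟩
  have hle : Hi ≤ Hn := WeierstrassCurve.localSubgroup_ker_le_layer κ E n
  -- (1) `H_{E,∞}` and `g` generate `H_{E,n}` (inside the topological group `H_{E,n}`)
  have hgen' : ∀ U : Subgroup Hn, IsOpen (U : Set Hn) → N ≤ U → γ ∈ U → U = ⊤ := by
    intro U hU hNU hγU
    let U' : Subgroup (Field.absoluteGaloisGroup E) := U.map Hn.subtype
    have hopen : IsOpen (U' : Set (Field.absoluteGaloisGroup E)) :=
      (isOpen_localSubgroup_layerSubgroup E κ n).isOpenMap_subtype_val _ hU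
    have hN' : Hi ≤ U' := fun τ hτ ↦
      ⟨⟨τ, hle hτ⟩, hNU (Subgroup.mem_subgroupOf.mpr hτ), rfl⟩
    have hγU' : g ∈ U' := ⟨γ, hγU, rfl⟩
    have hle' := hgen U' hopen hN' hγU'
    rw [eq_top_iff]
    intro x _
    obtain ⟨u, hu, hux⟩ := hle' x.2
    have : u = x := Subtype.ext hux
    exact this ▸ hu
  -- (2) orbit maps on `H_{E,n}` are continuous
  have hcont : ∀ m : P, Continuous fun x : Hn ↦ x • m := fun m ↦
    (continuous_smul_localPoints W E m).comp continuous_subtype_val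
  -- (3) `P^N = P^{H_{E,∞}}`, compatibly with `g - 1`
  have hfix : FixedPoints.addSubgroup N P = FixedPoints.addSubgroup Hi P := by
    ext m
    simp only [FixedPoints.mem_addSubgroup]
    constructor
    · intro h τ
      exact h ⟨⟨τ, hle τ.2⟩, Subgroup.mem_subgroupOf.mpr τ.2⟩
    · intro h x
      exact h ⟨((x : Hn) : Field.absoluteGaloisGroup E), Subgroup.mem_subgroupOf.mp x.2⟩
  let e : FixedPoints.addSubgroup N P ≃+ FixedPoints.addSubgroup Hi P :=
    AddEquiv.addSubgroupCongr hfix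
  have he : AddSubgroup.map (e : FixedPoints.addSubgroup N P →+ FixedPoints.addSubgroup Hi P)
      (subOne N P γ).range = (subOne Hi P g).range := by
    ext b
    constructor
    · rintro ⟨x, ⟨y, rfl⟩, rfl⟩
      exact ⟨e y, Subtype.ext rfl⟩
    · rintro ⟨y, rfl⟩
      exact ⟨subOne N P γ (e.symm y), ⟨e.symm y, rfl⟩, Subtype.ext rfl⟩
  let eq : FixedPoints.addSubgroup N P ⧸ (subOne N P γ).range ≃+
      FixedPoints.addSubgroup Hi P ⧸ (subOne Hi P g).range :=
    QuotientAddGroup.congr _ _ e he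
  -- (4) the generic embedding on `H_{E,n}`
  obtain ⟨w, hw, -⟩ := exists_addMonoidHom_subgroupResKer_injective N P γ hgen' hcont
  -- (5) `𝒦_{E,n} ⊆ ker (res : H¹(H_{E,n}, P) → H¹(N, P))`
  have hker : W.localTowerKer κ E n ≤ subgroupResKer P N := by
    intro c hc
    let j : N →ₜ* Hi :=
      { toFun := fun x ↦ ⟨((x : Hn) : Field.absoluteGaloisGroup E), Subgroup.mem_subgroupOf.mp x.2⟩
        map_one' := rfl
        map_mul' := fun _ _ ↦ rfl
        continuous_toFun :=
          (continuous_subtype_val.comp continuous_subtype_val).subtype_mk _ }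
    have hcomp : (resH1Hom j (AddMonoidHom.id P) (fun _ _ ↦ rfl)).comp
        (Literature.NumberTheory.EllipticCurves.resOfLe P hle) = resSubgroup N P := by
      unfold Literature.NumberTheory.EllipticCurves.resOfLe ResKernel.resSubgroup
      rw [resH1Hom_comp]
      exact resH1Hom_congr (ContinuousMonoidHom.ext fun _ ↦ rfl) (AddMonoidHom.ext fun _ ↦ rfl) _ _
    rw [mem_subgroupResKer_iff, ← hcomp, AddMonoidHom.comp_apply,
      (W.mem_localTowerKer_iff κ E n c).mp hc, map_zero]
  -- (6) the composite `𝒦_{E,n} → ker res → (P^N/(γ-1)) ≃ (P^{H_∞}/(g-1))`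
  let incl : W.localTowerKer κ E n →+ subgroupResKer P N :=
    (AddSubgroup.inclusion hker)
  refine ⟨(eq : _ ≃+ _).toAddMonoidHom.comp (w.comp incl), ?_⟩
  exact eq.injective.comp (hw.comp (AddSubgroup.inclusion_injective hker))

end Embedding

/-! ## §2 Pure algebra: `p`-power torsion classes of coinvariants come from the `p`-power torsion -/

/-- **Every `p`-power torsion class of `M/f(M)` is the class of an element of `B = M[p^∞]`**, when
`M/B` is `p`-divisible (the representative step of the tree's
`PrimaryCoinvariants.finite_primaryComponent_quotient`, isolated: for `p^k x = f(y)` write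
`y = p^k y' + b`, then `x − f(y') ∈ B` has the same class). Greenberg, LNM 1716, proof of Lemma 3.3
(p. 87). [folklore] -/
private theorem exists_primary_mk_eq {M : Type*} [AddCommGroup M] (p : ℕ) (f : M →+ M)
    (hdiv : ∀ y : M, ∃ y' : M, y - p • y' ∈ AddCommGroup.primaryComponent M p)
    (q : M ⧸ f.range) (hq : q ∈ AddCommGroup.primaryComponent (M ⧸ f.range) p) :
    ∃ b : M, b ∈ AddCommGroup.primaryComponent M p ∧ (b : M ⧸ f.range) = q := by
  induction q using QuotientAddGroup.induction_on with
  | H x =>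
    rw [PrimaryCoinvariants.mem_primaryComponent_iff_exists_nsmul] at hq
    obtain ⟨k, hk⟩ := hq
    rw [← QuotientAddGroup.mk_nsmul, QuotientAddGroup.eq_zero_iff] at hk
    obtain ⟨y, hy⟩ := hk
    obtain ⟨y', hy'⟩ := PrimaryCoinvariants.exists_sub_pow_smul_mem p hdiv k y
    have hmem : x - f y' ∈ AddCommGroup.primaryComponent M p := by
      refine PrimaryCoinvariants.mem_primaryComponent_of_nsmul_mem p (k := k) ?_
      have e : p ^ k • (x - f y') = f (y - p ^ k • y') := by
        rw [smul_sub, map_sub, map_nsmul, hy]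
      rw [e]
      exact PrimaryCoinvariants.map_mem_primaryComponent p f hy'
    refine ⟨x - f y', hmem, ?_⟩
    rw [QuotientAddGroup.eq_iff_sub_mem]
    exact ⟨-y', by rw [map_neg]; abel⟩


/-! ## §3 `#𝒦_{v,n}[p] ≤ p²` at every `v ∤ p`, every layer, any reduction type -/

section Main

variable {K : Type u} [Field K] [NumberField K] (W : WeierstrassCurve K) {v : HeightOneSpectrum (𝓞 K)}
  {p : ℕ} [Fact p.Prime] (κ : ZpExtension K p)

set_option maxHeartbeats 1600000 in
/-- **Greenberg's Lemma 3.3 at EVERY layer, counted on the `p`-torsion, for ANY reduction type: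
`#𝒦_{v,n}[p] ≤ p²` at `v ∤ p`.** For an elliptic curve `E` over a number field `K`, ANY
`ℤ_p`-extension `κ`, a finite place `v ∤ p` (good or bad) and every `n`, the classes of the local tower
kernel `𝒦_{v,n} = ker (H¹(H_{v,n}, E(K̄_v)) → H¹(H_{v,∞}, E(K̄_v)))` killed by `p` are finitely many, at
most `p² = #E[p]`. Proof (Greenberg, LNM 1716, p. 87: "`ker(r_{v_n}) ≅ B_v/(γ_{v_n} − 1)B_v`", "`B_v`
is isomorphic to `(ℚ_p/ℤ_p)^e ×` (a finite group), where `0 ≤ e ≤ 2`" — so every subquotient of `B_v`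
has `p`-rank `≤ 2`): `𝒦_{v,n} ↪ M_∞/(g−1)M_∞` (`exists_addMonoidHom_localTowerKer_injective`,
`M_∞ = E(K̄_v)^{H_{v,∞}}`); the `p`-power torsion of the target is the image of `B = M_∞[p^∞]`
(`M_∞/B` is `p`-divisible: step (a) of the tree's layer-`0` Lemma 3.3, Kodaira–Néron over `K_v^nr` and
division in `E₁`, verbatim), i.e. a quotient `B/C`; and `#(B/C)[p] ≤ #B[p] ≤ #E(K̄_v)[p] = p²`
(`finite_and_natCard_pTorsion_quotient_le`, Silverman III.6.4). No Tamagawa number, no reduction type,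
no finiteness of `E((K_n)_{v_n})[p^∞]` is used; at `p = 2` this is the constant `C_v = 4` of the TOWER
gap certificate at every odd bad place, hitherto read from p. 88 (additive: `c_v ≤ 4`).
[cite: GreenbergLNM1716, §3 Lemma 3.3 (proof, pp. 87–88)] [cite: SilvermanAEC2009, Cor. III.6.4, Cor. VII.6.2, Prop. VII.3.1] -/
theorem finite_and_natCard_pTorsion_localTowerKerPrimary_le_sq [W.IsElliptic]
    (hpv : (p : 𝓞 K) ∉ v.asIdeal) (n : ℕ) :
    Finite {x : W.localTowerKerPrimary κ (v.adicCompletion K) n // p • x = 0} ∧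
      Nat.card {x : W.localTowerKerPrimary κ (v.adicCompletion K) n // p • x = 0} ≤ p ^ 2 := by
  classical
  -- notation, a generator `g` of `H_{v,n}/H_{v,∞}`, the embedding `ψ`
  let G : Type u := Field.absoluteGaloisGroup (v.adicCompletion K)
  let Pt : Type u := localPoints W (v.adicCompletion K)
  let Hi : Subgroup G := localSubgroup κ.kerSubgroup (v.adicCompletion K)
  obtain ⟨g, hg, hgen⟩ :=
    ZpExtension.exists_mem_localSubgroup_generate κ (v.adicCompletion K) n
  -- the prime `𝔐`, `p ∈ 𝓞_vˣ`, inertia `≤ H_{v,∞}`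
  obtain ⟨w, hw⟩ := v.exists_spectralValuation
  obtain ⟨𝔐, h𝔐⟩ := v.localPrimesAbove_nonempty
  have hp : IsUnit ((p : ℕ) : (v.adicCompletionIntegers K)) := by
    have h := isUnit_algebraMap_adicCompletionIntegers K v hpv
    rwa [map_natCast] at h
  have hI : ∀ σ ∈ 𝔐.inertia G, σ ∈ Hi := fun σ hσ ↦
    (mem_localSubgroup_iff _ _ σ).mpr
      (ZpExtension.inertia_le_kerSubgroup_holds K p κ hpv (primeBelow_mem_primesAbove h𝔐)
        (v.resGalOfEmb_mem_inertia_primeBelow (closureEmb (K := K) (v.adicCompletion K)) 𝔐 hσ))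
  -- the equivariant transport `E(K̄_v) ≃ V(K̄_v)` to the minimal model
  obtain ⟨C, hC⟩ := W.exists_variableChange_eq_localMinimalIntegralModel v
  haveI := WeierstrassCurve.isIntegral_spectralValuation_baseChange hw (W.localMinimalIntegralModel v)
  have hC' := congrArg (fun X : WeierstrassCurve (v.adicCompletion K) ↦ X.baseChange (AlgebraicClosure (v.adicCompletion K))) hC
  let Φ : Pt ≃+ (((W.localMinimalIntegralModel v).map (algebraMap (v.adicCompletionIntegers K) (v.adicCompletion K))).baseChange (AlgebraicClosure (v.adicCompletion K))).toAffine.Point :=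
    ((WeierstrassCurve.Affine.Point.congrEquiv
        (WeierstrassCurve.baseChange_baseChange_adicCompletion W v).symm).trans
      (WeierstrassCurve.VariableChange.pointEquivBaseChange (W.baseChange (v.adicCompletion K)) C
        (AlgebraicClosure (v.adicCompletion K)))).trans
      (WeierstrassCurve.Affine.Point.congrEquiv hC')
  have hΦ : ∀ (σ : G) (Q : Pt), Φ (σ • Q) = Affine.Point.map ((absoluteGaloisGroup.toAlgEquiv (v.adicCompletion K) σ : AlgebraicClosure (v.adicCompletion K) ≃ₐ[v.adicCompletion K] AlgebraicClosure (v.adicCompletion K)) : AlgebraicClosure (v.adicCompletion K) →ₐ[v.adicCompletion K] AlgebraicClosure (v.adicCompletion K)) (Φ Q) := by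
    intro σ Q
    change WeierstrassCurve.Affine.Point.congrEquiv hC'
        (WeierstrassCurve.VariableChange.pointEquivBaseChange (W.baseChange (v.adicCompletion K)) C (AlgebraicClosure (v.adicCompletion K))
        (WeierstrassCurve.Affine.Point.congrEquiv (WeierstrassCurve.baseChange_baseChange_adicCompletion W v).symm (σ • Q))) =
      WeierstrassCurve.Affine.Point.map _ (WeierstrassCurve.Affine.Point.congrEquiv hC'
        (WeierstrassCurve.VariableChange.pointEquivBaseChange (W.baseChange (v.adicCompletion K)) C (AlgebraicClosure (v.adicCompletion K))
          (WeierstrassCurve.Affine.Point.congrEquiv (WeierstrassCurve.baseChange_baseChange_adicCompletion W v).symm Q)))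
    rw [WeierstrassCurve.congrEquiv_smul, WeierstrassCurve.VariableChange.pointEquivBaseChange_map_algEquiv]
    exact WeierstrassCurve.Affine.Point.congrEquiv_baseChange_map hC _ _
  -- `M_∞ = E(K̄_v)^{H_{v,∞}}`, `f = g - 1`, `B = M_∞[p^∞]`
  set Mi : AddSubgroup Pt := FixedPoints.addSubgroup Hi Pt with hMi
  set f : Mi →+ Mi := subOne Hi Pt g with hf
  set B : AddSubgroup Mi := AddCommGroup.primaryComponent Mi p with hB
  have hMiI : ∀ (m : Mi) (τ : G), τ ∈ 𝔐.inertia G → Affine.Point.map ((absoluteGaloisGroup.toAlgEquiv (v.adicCompletion K) τ : AlgebraicClosure (v.adicCompletion K) ≃ₐ[v.adicCompletion K] AlgebraicClosure (v.adicCompletion K)) : AlgebraicClosure (v.adicCompletion K) →ₐ[v.adicCompletion K] AlgebraicClosure (v.adicCompletion K)) (Φ m) = Φ m := by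
    intro m τ hτ
    rw [← hΦ]
    exact congrArg Φ (m.2 ⟨τ, hI τ hτ⟩)
  -- (a) `M_∞/B` is `p`-divisible (verbatim from the tree's Lemma 3.3 at `n = 0`)
  have hdiv : ∀ y : Mi, ∃ y' : Mi, y - p • y' ∈ B := by
    intro y
    obtain ⟨m, hm, hmK⟩ :=
      W.exists_nsmul_mem_kernel_of_forall_inertia hw h𝔐 (P := Φ y) (fun τ hτ ↦ hMiI y τ hτ)
    obtain ⟨a, b, hb, hmab⟩ :=
      Nat.exists_eq_pow_mul_and_not_dvd hm.ne' p (Fact.out : p.Prime).ne_one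
    have hmI : ∀ τ ∈ 𝔐.inertia G, Affine.Point.map ((absoluteGaloisGroup.toAlgEquiv (v.adicCompletion K) τ : AlgebraicClosure (v.adicCompletion K) ≃ₐ[v.adicCompletion K] AlgebraicClosure (v.adicCompletion K)) : AlgebraicClosure (v.adicCompletion K) →ₐ[v.adicCompletion K] AlgebraicClosure (v.adicCompletion K)) (m • Φ y) = m • Φ y :=
      fun τ hτ ↦ by rw [map_nsmul, hMiI y τ hτ]
    obtain ⟨u, -, hufix, hu⟩ := W.exists_pow_nsmul_eq_of_mem_kernel hw h𝔐 hp (a + 1) hmK hmI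
    have hu' : Φ.symm u ∈ Mi := by
      rintro ⟨h, hh⟩
      show h • Φ.symm u = Φ.symm u
      apply Φ.injective
      rw [hΦ, AddEquiv.apply_symm_apply]
      refine hufix h ?_
      rw [map_nsmul, ← hΦ]
      exact congrArg (fun z ↦ m • Φ z) (y.2 ⟨h, hh⟩)
    set u' : Mi := ⟨Φ.symm u, hu'⟩ with hu'def
    have hT₀ : b • y - p • u' ∈ B := by
      rw [hB, PrimaryCoinvariants.mem_primaryComponent_iff_exists_nsmul]
      refine ⟨a, ?_⟩
      apply Subtype.ext
      apply Φ.injective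
      simp only [smul_sub, AddSubgroupClass.coe_nsmul, AddSubgroupClass.coe_sub, map_sub, map_nsmul,
        ZeroMemClass.coe_zero, map_zero, hu'def, AddEquiv.apply_symm_apply]
      rw [← mul_smul, ← mul_smul, ← pow_succ, hu, ← hmab, sub_self]
    have hcop : IsCoprime (b : ℤ) (p : ℤ) :=
      Nat.isCoprime_iff_coprime.mpr ((Nat.Prime.coprime_iff_not_dvd Fact.out).mpr hb).symm
    obtain ⟨α, β, hαβ⟩ := hcop
    refine ⟨α • u' + β • y, ?_⟩
    have e : y - p • (α • u' + β • y) = α • (b • y - p • u') := by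
      have h2 : (1 - (α * b + β * p)) • y = 0 := by rw [hαβ, sub_self, zero_smul]
      have h3 : y - p • (α • u' + β • y) - α • (b • y - p • u') = (1 - (α * b + β * p)) • y := by
        module
      rw [← sub_eq_zero, h3, h2]
    rw [e]
    exact B.zsmul_mem hT₀ α
  -- `B` is `p`-primary with finite `p^k`-torsion and `#B[p] ≤ p²`
  have hBprim : ∀ b : B, ∃ k : ℕ, p ^ k • b = 0 := fun b ↦ by
    obtain ⟨k, hk⟩ := (PrimaryCoinvariants.mem_primaryComponent_iff_exists_nsmul p (b : Mi)).mp b.2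
    exact ⟨k, Subtype.ext hk⟩
  have hcoe : ∀ (n : ℕ) (b : B), ((((n • b : B) : Mi)) : Pt) = n • (((b : B) : Mi) : Pt) := fun n b ↦ by
    simp only [AddSubgroupClass.coe_nsmul]
  haveI : CharZero (AlgebraicClosure (v.adicCompletion K)) :=
    charZero_of_injective_algebraMap (algebraMap K _).injective
  have htors : ∀ n : ℕ, ∃ ι : (nsmulAddMonoidHom (p ^ n) : B →+ B).ker →
      AddSubgroup.torsionBy (W.baseChange (AlgebraicClosure (v.adicCompletion K))).toAffine.Point
        ((p ^ n : ℕ) : ℤ), Function.Injective ι := by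
    intro n
    refine ⟨fun x ↦ ⟨(((x : B) : Mi) : Pt), ?_⟩, ?_⟩
    · have hx : p ^ n • (x : B) = 0 := (AddMonoidHom.mem_ker).mp x.2
      show (((p ^ n : ℕ) : ℤ)) • (((x : B) : Mi) : Pt) = 0
      rw [natCast_zsmul, ← hcoe, hx]; rfl
    · intro a b hab
      have h := congrArg Subtype.val hab
      apply Subtype.ext; apply Subtype.ext; apply Subtype.ext
      exact h
  have hfinn : ∀ n : ℕ, Finite (nsmulAddMonoidHom (p ^ n) : B →+ B).ker := by
    intro n
    have hn0 : (((p ^ n : ℕ) : ℤ)) ≠ 0 := by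
      exact_mod_cast pow_ne_zero n (Fact.out : p.Prime).ne_zero
    haveI := finite_torsionBy_baseChange W (AlgebraicClosure (v.adicCompletion K)) hn0
    obtain ⟨ι, hι⟩ := htors n
    exact Finite.of_injective ι hι
  have hBp : Nat.card (nsmulAddMonoidHom p : B →+ B).ker ≤ p ^ 2 := by
    obtain ⟨ι, hι⟩ := htors 1
    have h1 : Nat.card (AddSubgroup.torsionBy
        (W.baseChange (AlgebraicClosure (v.adicCompletion K))).toAffine.Point ((p ^ 1 : ℕ) : ℤ)) =
        (p ^ 1) ^ 2 :=
      WeierstrassCurve.card_torsionPoints_eq_sq_holds W (AlgebraicClosure (v.adicCompletion K))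
        (n := p ^ 1) (by exact_mod_cast pow_ne_zero 1 (Fact.out : p.Prime).ne_zero)
    haveI : Finite (AddSubgroup.torsionBy
        (W.baseChange (AlgebraicClosure (v.adicCompletion K))).toAffine.Point ((p ^ 1 : ℕ) : ℤ)) :=
      Nat.finite_of_card_ne_zero (by rw [h1]; exact pow_ne_zero _ (pow_ne_zero _ (Fact.out : p.Prime).ne_zero))
    have := Nat.card_le_card_of_injective ι hι
    rw [pow_one] at this h1
    rw [← h1]
    exact this
  -- `π : B → Q`, `Q = M_∞/(g-1)M_∞`; its image is the `p`-power torsion of `Q`; the embedding `ψ`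
  let π : B →+ Mi ⧸ f.range := (QuotientAddGroup.mk' f.range).comp B.subtype
  obtain ⟨ψ, hψ⟩ := exists_addMonoidHom_localTowerKer_injective W κ (v.adicCompletion K) n hg hgen
  obtain ⟨hfinBC, hBC⟩ := finite_and_natCard_pTorsion_quotient_le hBprim hfinn π.ker
  -- the map `𝒦_{v,n}[p] → (B/ker π)[p]`
  have hrange : ∀ x : {x : W.localTowerKerPrimary κ (v.adicCompletion K) n // p • x = 0},
      ψ ⟨(x.1 : _), x.1.2.1⟩ ∈ π.range := by
    intro x
    obtain ⟨k, hk⟩ := x.1.2.2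
    have hq : ψ ⟨(x.1 : _), x.1.2.1⟩ ∈ AddCommGroup.primaryComponent (Mi ⧸ f.range) p := by
      rw [PrimaryCoinvariants.mem_primaryComponent_iff_exists_nsmul]
      refine ⟨k, ?_⟩
      rw [← map_nsmul]
      have : p ^ k • (⟨(x.1 : _), x.1.2.1⟩ : W.localTowerKer κ (v.adicCompletion K) n) = 0 :=
        Subtype.ext hk
      rw [this, map_zero]
    obtain ⟨b, hb, hbq⟩ := exists_primary_mk_eq p f hdiv _ hq
    exact ⟨⟨b, hb⟩, hbq⟩
  let Θ : {x : W.localTowerKerPrimary κ (v.adicCompletion K) n // p • x = 0} →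
      {y : B ⧸ π.ker // p • y = 0} := fun x ↦
    ⟨(QuotientAddGroup.quotientKerEquivRange π).symm ⟨_, hrange x⟩, by
      rw [← map_nsmul, AddEquiv.map_eq_zero_iff]
      apply Subtype.ext
      change p • ψ ⟨(x.1 : _), x.1.2.1⟩ = 0
      rw [← map_nsmul]
      have hx2 := congrArg Subtype.val x.2
      rw [AddSubgroupClass.coe_nsmul, ZeroMemClass.coe_zero] at hx2
      have : p • (⟨(x.1 : _), x.1.2.1⟩ : W.localTowerKer κ (v.adicCompletion K) n) = 0 :=
        Subtype.ext (by rw [AddSubgroupClass.coe_nsmul, ZeroMemClass.coe_zero]; exact hx2)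
      rw [this, map_zero]⟩
  have hΘ : Function.Injective Θ := by
    intro x y hxy
    have h1 := congrArg (fun z : {y : B ⧸ π.ker // p • y = 0} ↦
      ((QuotientAddGroup.quotientKerEquivRange π) z.1 : Mi ⧸ f.range)) hxy
    simp only [Θ, AddEquiv.apply_symm_apply] at h1
    have h2 := hψ h1
    have h3 : x.1.1 = y.1.1 :=
      congrArg (fun z : W.localTowerKer κ (v.adicCompletion K) n ↦ z.1) h2
    exact Subtype.ext (Subtype.ext h3)
  haveI := hfinBC
  exact ⟨Finite.of_injective Θ hΘ, (Nat.card_le_card_of_injective Θ hΘ).trans (hBC.trans hBp)⟩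

end Main

end Literature.NumberTheory.EllipticCurves.Greenberg1999
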